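import Mathlib.Probability.Independence.Integration
import Literature.Probability.Percolation.ArmEventsInterface
import Literature.Probability.Percolation.MacroscopicInterfaceLoop
import Literature.Probability.Percolation.SitePercolationMeasure
import Literature.Probability.RandomPlanarGeometry.NestingTransform
import HarnessLib

/-!
# Reading sites of honeycomb interface loops; independence of disjointly determined observables

Crux `Summit.CriticalPhenomena.CardyFormulaZ2.Theses.CardyMagicRigidity.NestingRigidity`
(stmt-CriticalPhenomena-4835), line `markov-cascade-one-generation`, helper toward the registered stub
`stub_oneGenerationT : OneGenerationT` (S2: the exact one-generation factorisation of the nesting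
transform on site-`𝕋`).  Two lattice / measure-theoretic inputs of that factorisation, independent of
the line's vocabulary module:

* §1 **the cylinder structure of `IsSiteInterfaceLoop ω w`.**  The event reads exactly the sites
  `x = e.fst ∨ x = e.snd` of the `𝕋`-darts `e` crossed by the darts of `w` (the body of the line's
  `loopSitesT`): these are the left/right sites `lv i`, `rv i` of the steps
  (`exists_eq_lv_or_rv`, the crossed dart is unique, `eq_of_triEdgeFaces_eq`), the
  event only depends on them (`isSiteInterfaceLoop_congr`) and PINS them (`mem_iff_of_read`:
  two configurations carrying the loop agree on every read site);
  **reading sites of enclosed loops** (`loopWind_ne_zero_of_enclosed`): if the closed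
  polygon of `w` winds about every site about which that of a second interface loop `w'` of the same
  configuration winds, then every site read by `w'` is enclosed by `w` or read by `w` (jump of the
  winding number across a crossed edge, transport across an uncrossed one, `SiteInterfaceWinding.lean`);
  and the sites enclosed by a loop form a finite set (`finite_setOf_loopWind_ne_zero`);
* §2 **independence under the product measure** `sitePercolation V p`: the coordinates `ω ↦ (v ∈ ω)` are
  independent (`iIndepFun_mem_sitePercolation`), so two measurable observables determined by disjoint
  sets of sites are independent (`indepFun_of_determined`, through `indep_iSup_of_disjoint`) and their
  product integrates to the product of the integrals (`integral_mul_of_determined`, registered helper);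
  an observable read through finitely many sites is automatically measurable (`measurable_comp_inter_of_finite`);
* §3 three pieces of bookkeeping for the nesting weight: a loop whose interior contains or misses the
  support of a neutral density weighs `1` (`nestingFactor_eq_one_of_subset_or_disjoint`), a `finprod` may
  be restricted to the factors different from `1` (`finprod_mem_eq_of_eq_one_off`), and a set integral is
  the integral against the indicator (`setIntegral_eq_integral_mul_indicator_one`).
-/

noncomputable section

open Set Metric MeasureTheory ProbabilityTheory

namespace Summit.CriticalPhenomena.CardyFormulaZ2.Cruxes.NestingRigidity.MarkovCascadeOneGeneration

open Literature.Probability.RandomPlanarGeometry Literature.Probability.Percolation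
  Literature.Probability.LatticeModels

/-! ## §1 The sites read by an interface loop -/

section Read

variable {ω ω' : SiteConfig (Site 2)} {f₀ f₁ : HexVertex} {w : hexGraph.Walk f₀ f₀} {w' : hexGraph.Walk f₁ f₁}

/-- The `i`-th dart of a walk joins its `i`-th and `(i+1)`-st faces. -/
theorem exists_getElem_darts_eq {d : hexGraph.Dart} (hd : d ∈ w.darts) :
    ∃ i, i < w.length ∧ d.fst = w.getVert i ∧ d.snd = w.getVert (i + 1) := by
  obtain ⟨i, hi, rfl⟩ := List.getElem_of_mem hd
  refine ⟨i, by rwa [SimpleGraph.Walk.length_darts] at hi, ?_, ?_⟩ <;>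
    simp [SimpleGraph.Walk.darts_getElem_eq_getVert]

/-- **The crossed dart of a step is unique**: a `𝕋`-dart whose (left, right) faces are the (head, tail)
of the `i`-th dart of an interface loop is the dart `lv i → rv i`. -/
theorem eq_lv_rv_of_triEdgeFaces (hw : IsSiteInterfaceLoop ω w) {i : ℕ} (hi : i < w.length)
    {e : triGraph.Dart} (he : triEdgeFaces e = (w.getVert (i + 1), w.getVert i)) :
    e.fst = hw.lv i ∧ e.snd = hw.rv i := by
  obtain ⟨h, hfaces, -, -⟩ := hw.dart_spec hi
  obtain ⟨⟨a, b⟩, hab⟩ := e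
  exact eq_of_triEdgeFaces_eq hab h (he.trans hfaces.symm)

/-- **A site read by an interface loop is a left or a right site of one of its steps.** -/
theorem exists_eq_lv_or_rv (hw : IsSiteInterfaceLoop ω w) {x : Site 2} {d : hexGraph.Dart}
    (hd : d ∈ w.darts) {e : triGraph.Dart} (he : triEdgeFaces e = (d.snd, d.fst)) (hx : x = e.fst ∨ x = e.snd) :
    ∃ i, i < w.length ∧ (x = hw.lv i ∨ x = hw.rv i) := by
  obtain ⟨i, hi, h1, h2⟩ := exists_getElem_darts_eq hd
  rw [h1, h2] at he
  obtain ⟨hl, hr⟩ := eq_lv_rv_of_triEdgeFaces hw hi he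
  exact ⟨i, hi, by rwa [hl, hr] at hx⟩

/-- Conversely the left site of every step is read. -/
theorem lv_read (hw : IsSiteInterfaceLoop ω w) {i : ℕ} (hi : i < w.length) :
    ∃ d ∈ w.darts, ∃ e : triGraph.Dart, triEdgeFaces e = (d.snd, d.fst) ∧ (hw.lv i = e.fst ∨ hw.lv i = e.snd) := by
  obtain ⟨h, hfaces, -, -⟩ := hw.dart_spec hi
  have hi' : i < w.darts.length := by rwa [SimpleGraph.Walk.length_darts]
  refine ⟨w.darts[i], List.getElem_mem hi', ⟨(hw.lv i, hw.rv i), h⟩, ?_, Or.inl rfl⟩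
  rw [hfaces]; simp [SimpleGraph.Walk.darts_getElem_eq_getVert]

/-- Conversely the right site of every step is read. -/
theorem rv_read (hw : IsSiteInterfaceLoop ω w) {i : ℕ} (hi : i < w.length) :
    ∃ d ∈ w.darts, ∃ e : triGraph.Dart, triEdgeFaces e = (d.snd, d.fst) ∧ (hw.rv i = e.fst ∨ hw.rv i = e.snd) := by
  obtain ⟨h, hfaces, -, -⟩ := hw.dart_spec hi
  have hi' : i < w.darts.length := by rwa [SimpleGraph.Walk.length_darts]
  refine ⟨w.darts[i], List.getElem_mem hi', ⟨(hw.lv i, hw.rv i), h⟩, ?_, Or.inr rfl⟩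
  rw [hfaces]; simp [SimpleGraph.Walk.darts_getElem_eq_getVert]

/-- **`IsSiteInterfaceLoop · w` is determined by the read sites** (a cylinder event). -/
theorem isSiteInterfaceLoop_congr
    (h : ∀ x : Site 2, (∃ d ∈ w.darts, ∃ e : triGraph.Dart, triEdgeFaces e = (d.snd, d.fst) ∧ (x = e.fst ∨ x = e.snd)) →
      (x ∈ ω ↔ x ∈ ω')) :
    IsSiteInterfaceLoop ω w ↔ IsSiteInterfaceLoop ω' w := by
  refine and_congr_right fun _ ↦ forall₂_congr fun d hd ↦ exists_congr fun e ↦ and_congr_right fun he ↦ ?_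
  rw [h e.fst ⟨d, hd, e, he, Or.inl rfl⟩, h e.snd ⟨d, hd, e, he, Or.inr rfl⟩]

/-- **The event pins the read sites**: two configurations both carrying the interface loop `w` agree on
every site read by `w` (left sites are open, right sites closed, and the crossed dart is unique). -/
theorem mem_iff_of_read (hw : IsSiteInterfaceLoop ω w) (hw' : IsSiteInterfaceLoop ω' w)
    {x : Site 2} (hx : ∃ d ∈ w.darts, ∃ e : triGraph.Dart, triEdgeFaces e = (d.snd, d.fst) ∧ (x = e.fst ∨ x = e.snd)) :
    x ∈ ω ↔ x ∈ ω' := by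
  obtain ⟨d, hd, e, he, hx⟩ := hx
  obtain ⟨i, hi, h1, h2⟩ := exists_getElem_darts_eq hd
  rw [h1, h2] at he
  obtain ⟨hl, hr⟩ := eq_lv_rv_of_triEdgeFaces hw hi he
  obtain ⟨hl', hr'⟩ := eq_lv_rv_of_triEdgeFaces hw' hi he
  rcases hx with rfl | rfl
  · exact ⟨fun _ ↦ hl' ▸ hw'.lv_mem hi, fun _ ↦ hl ▸ hw.lv_mem hi⟩
  · exact ⟨fun h ↦ absurd h (hr ▸ hw.rv_not_mem hi), fun h ↦ absurd h (hr' ▸ hw'.rv_not_mem hi)⟩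

/-- **Reading sites of an enclosed loop.**  Let `w`, `w'` be interface loops of one configuration at
mesh `δ > 0` such that the polygon of `w` winds about every SITE about which the polygon of `w'`
winds.  Then for every step `i` of `w'`, either the polygon of `w` winds about both the left and the
right site of the step, or the step crosses an edge crossed by `w` (so both its sites are read by `w`):
one of the two sites is enclosed by `w'` (`loopWind_leftPt_ne_zero_or`), hence by `w`, and the winding
number of `w` is transported to the other across the edge unless `w` crosses it
(`loopWind_triMeshPoint_eq_of_adj`). -/
theorem loopWind_ne_zero_of_enclosed (hw : IsSiteInterfaceLoop ω w)
    (hw' : IsSiteInterfaceLoop ω w') {δ : ℝ} (hδ : 0 < δ)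
    (hsub : ∀ x : Site 2, loopWind δ w' (triMeshPoint δ x) ≠ 0 → loopWind δ w (triMeshPoint δ x) ≠ 0)
    {i : ℕ} (hi : i < w'.length) :
    (loopWind δ w (triMeshPoint δ (hw'.lv i)) ≠ 0 ∧ loopWind δ w (triMeshPoint δ (hw'.rv i)) ≠ 0) ∨
      ∃ j, j < w.length ∧ ((hw'.lv i = hw.lv j ∧ hw'.rv i = hw.rv j) ∨ (hw'.lv i = hw.rv j ∧ hw'.rv i = hw.lv j)) := by
  by_cases hex : ∃ j, j < w.length ∧
      ((hw'.lv i = hw.lv j ∧ hw'.rv i = hw.rv j) ∨ (hw'.lv i = hw.rv j ∧ hw'.rv i = hw.lv j))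
  · exact Or.inr hex
  have hex' : ∀ j < w.length, ¬(hw'.lv i = hw.lv j ∧ hw'.rv i = hw.rv j) ∧
      ¬(hw'.lv i = hw.rv j ∧ hw'.rv i = hw.lv j) := fun j hj ↦
    ⟨fun h ↦ hex ⟨j, hj, Or.inl h⟩, fun h ↦ hex ⟨j, hj, Or.inr h⟩⟩
  have htrans := hw.loopWind_triMeshPoint_eq_of_adj hδ (Or.inr (hw'.adj_lv_rv hi)) hex'
  left
  rcases hw'.loopWind_leftPt_ne_zero_or hδ hi with h | h
  · have h1 := hsub _ h
    exact ⟨h1, htrans ▸ h1⟩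
  · have h1 := hsub _ h
    exact ⟨htrans.symm ▸ h1, h1⟩

/-- **Only finitely many sites are enclosed by an interface loop** (the polygon is bounded and does not
wind about far sites, `loopWind_triMeshPoint_eq_zero_of_lt_norm`). -/
theorem finite_setOf_loopWind_ne_zero {δ : ℝ} (hδ : 0 < δ) (hlen : 0 < w.length) :
    {x : Site 2 | loopWind δ w (triMeshPoint δ x) ≠ 0}.Finite := by
  -- the trace is compact, hence in a ball
  have hcpt : IsCompact (polyTrace δ w) := by
    rw [← range_toCurve_eq_polyTrace hlen]
    exact isCompact_range (SimpleGraph.Walk.toCurve _ w).continuous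
  obtain ⟨ρ, hρ⟩ := hcpt.isBounded.subset_closedBall (0 : ℂ)
  set N : ℕ := ⌈2 * |ρ| / (Real.sqrt 3 * δ)⌉₊ with hN
  refine (triBall N).finite_toSet.subset fun v hv ↦ ?_
  rw [Finset.mem_coe, mem_triBall_iff]
  by_contra hlt
  push Not at hlt
  have h3 : 0 < Real.sqrt 3 := Real.sqrt_pos.2 (by norm_num)
  have hNv : (2 * |ρ| / (Real.sqrt 3 * δ) : ℝ) < triNorm v := by
    have h1 : (N : ℝ) < triNorm v := by exact_mod_cast hlt
    exact (Nat.le_ceil _).trans_lt h1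
  have hfar : ρ < δ * ‖triEmbed v‖ := by
    have h2 := mul_triNorm_le_norm_triEmbed v
    rw [div_lt_iff₀ (mul_pos h3 hδ)] at hNv
    nlinarith [abs_nonneg ρ, le_abs_self ρ, h2, hδ]
  exact hv (loopWind_triMeshPoint_eq_zero_of_lt_norm hδ hlen hρ hfar)

end Read

/-! ## §2 Independence of observables determined by disjoint sets of sites -/

section Indep

variable {V : Type*}

/-- **The coordinates of site percolation are independent**: under `sitePercolation V p` (push-forward of
the product Bernoulli measure `sitePi V p` along `setOf`) the events `v ∈ ω`, `v : V`, are mutually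
independent (`iIndepFun_iff_map_fun_eq_infinitePi_map`: the joint law of the coordinates is `sitePi V p`
itself and each marginal is `bernoulliProp p`). -/
theorem iIndepFun_mem_sitePercolation (V : Type*) (p : unitInterval) :
    iIndepFun (fun (v : V) (ω : SiteConfig V) ↦ v ∈ ω) (sitePercolation V p) := by
  rw [iIndepFun_iff_map_fun_eq_infinitePi_map fun v ↦ measurable_set_mem v]
  have h1 : (sitePercolation V p).map (fun (ω : SiteConfig V) (v : V) ↦ v ∈ ω) = sitePi V p := by
    rw [sitePercolation_eq_map, Measure.map_map (by fun_prop) (by fun_prop)]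
    exact Measure.map_id
  have h2 : ∀ v : V, (sitePercolation V p).map (fun ω : SiteConfig V ↦ v ∈ ω) = bernoulliProp p := fun v ↦ by
    rw [sitePercolation_eq_map, Measure.map_map (measurable_set_mem v) (by fun_prop)]
    exact Measure.infinitePi_map_eval (fun _ : V ↦ bernoulliProp p) v
  rw [h1]
  simp_rw [h2]
  rfl

/-- The σ-algebra generated by the coordinates in `S`. -/
theorem measurable_inter_of_subset (S : Set V) :
    Measurable[⨆ v ∈ S, MeasurableSpace.comap (fun ω : SiteConfig V ↦ v ∈ ω) inferInstance]
      (fun ω : SiteConfig V ↦ ω ∩ S) := by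
  set mS : MeasurableSpace (SiteConfig V) :=
    ⨆ v ∈ S, MeasurableSpace.comap (fun ω : SiteConfig V ↦ v ∈ ω) inferInstance with hmS
  refine @measurable_set_iff V (SiteConfig V) mS (fun ω : SiteConfig V ↦ ω ∩ S) |>.2 fun a ↦ ?_
  by_cases ha : a ∈ S
  · have hle : MeasurableSpace.comap (fun ω : SiteConfig V ↦ a ∈ ω) inferInstance ≤ mS :=
      le_iSup₂ (f := fun (v : V) (_ : v ∈ S) ↦ MeasurableSpace.comap (fun ω : SiteConfig V ↦ v ∈ ω) inferInstance) a ha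
    have h1 : Measurable[mS] (fun ω : SiteConfig V ↦ a ∈ ω) := Measurable.of_comap_le hle
    have h2 : (fun ω : SiteConfig V ↦ a ∈ ω ∩ S) = fun ω ↦ a ∈ ω := by
      funext ω; exact propext ⟨fun h ↦ h.1, fun h ↦ ⟨h, ha⟩⟩
    rw [h2]; exact h1
  · have h2 : (fun ω : SiteConfig V ↦ a ∈ ω ∩ S) = fun _ ↦ False := by
      funext ω; exact propext ⟨fun h ↦ ha h.2, False.elim⟩
    rw [h2]; exact measurable_const

/-- **An observable determined by the sites of `S` is measurable for the σ-algebra of the coordinates in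
`S`**: `comap φ ≤ ⨆_{v ∈ S} σ(v ∈ ·)` (factor `φ` through `ω ↦ ω ∩ S`). -/
theorem comap_le_of_determined {β : Type*} [mβ : MeasurableSpace β] {S : Set V} {φ : SiteConfig V → β}
    (hφm : Measurable φ) (hφ : ∀ ω, φ (ω ∩ S) = φ ω) :
    MeasurableSpace.comap φ mβ ≤ ⨆ v ∈ S, MeasurableSpace.comap (fun ω : SiteConfig V ↦ v ∈ ω) inferInstance := by
  have hfac : φ = φ ∘ fun ω ↦ ω ∩ S := funext fun ω ↦ (hφ ω).symm
  rw [hfac]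
  exact (hφm.comp (measurable_inter_of_subset S)).comap_le

/-- **Observables determined by disjoint sets of sites are independent** under `sitePercolation V p`. -/
theorem indepFun_of_determined (p : unitInterval) {S T : Set V} (hST : Disjoint S T)
    {β γ : Type*} [MeasurableSpace β] [MeasurableSpace γ] {φ : SiteConfig V → β} {ψ : SiteConfig V → γ}
    (hφm : Measurable φ) (hψm : Measurable ψ) (hφ : ∀ ω, φ (ω ∩ S) = φ ω) (hψ : ∀ ω, ψ (ω ∩ T) = ψ ω) :
    IndepFun φ ψ (sitePercolation V p) := by
  have hind := (iIndepFun_mem_sitePercolation V p).iIndep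
  have hle : ∀ v : V, MeasurableSpace.comap (fun ω : SiteConfig V ↦ v ∈ ω) inferInstance ≤
      (inferInstance : MeasurableSpace (SiteConfig V)) := fun v ↦ (measurable_set_mem v).comap_le
  have hI := indep_iSup_of_disjoint hle hind hST
  rw [IndepFun_iff_Indep]
  exact indep_of_indep_of_le_right (indep_of_indep_of_le_left hI (comap_le_of_determined hφm hφ))
    (comap_le_of_determined hψm hψ)

/-- **Product formula**: for real observables determined by disjoint sets of sites,
`E[φ ψ] = E[φ] E[ψ]` under `sitePercolation V p` (no integrability needed,
`IndepFun.integral_mul_eq_mul_integral`). -/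
theorem integral_mul_of_determined : ∀ (p : unitInterval) {S T : Set V}, Disjoint S T → ∀ {φ ψ : SiteConfig V → ℝ}, Measurable φ → Measurable ψ → (∀ ω, φ (ω ∩ S) = φ ω) → (∀ ω, ψ (ω ∩ T) = ψ ω) → ∫ ω, φ ω * ψ ω ∂(sitePercolation V p) = (∫ ω, φ ω ∂(sitePercolation V p)) * ∫ ω, ψ ω ∂(sitePercolation V p) := by
  intro p S T hST φ ψ hφm hψm hφ hψ
  exact (indepFun_of_determined p hST hφm hψm hφ hψ).integral_mul_eq_mul_integral
    hφm.aestronglyMeasurable hψm.aestronglyMeasurable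

/-- The same for probabilities of intersections of events determined by disjoint sets of sites. -/
theorem measureReal_inter_of_determined (p : unitInterval) {S T : Set V} (hST : Disjoint S T)
    {A B : Set (SiteConfig V)} (hAm : MeasurableSet A) (hBm : MeasurableSet B)
    (hA : ∀ ω, ω ∩ S ∈ A ↔ ω ∈ A) (hB : ∀ ω, ω ∩ T ∈ B ↔ ω ∈ B) :
    (sitePercolation V p).real (A ∩ B) = (sitePercolation V p).real A * (sitePercolation V p).real B := by
  have h := integral_mul_of_determined p hST (φ := A.indicator 1) (ψ := B.indicator 1)
    ((measurable_indicator_const_iff 1).2 hAm) ((measurable_indicator_const_iff 1).2 hBm)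
    (fun ω ↦ by
      by_cases h : ω ∈ A
      · rw [indicator_of_mem h, indicator_of_mem ((hA ω).2 h)]; rfl
      · rw [indicator_of_notMem h, indicator_of_notMem (mt (hA ω).1 h)])
    (fun ω ↦ by
      by_cases h : ω ∈ B
      · rw [indicator_of_mem h, indicator_of_mem ((hB ω).2 h)]; rfl
      · rw [indicator_of_notMem h, indicator_of_notMem (mt (hB ω).1 h)])
  rw [integral_indicator_one hAm, integral_indicator_one hBm] at h
  rw [← h, ← integral_indicator_one (hAm.inter hBm)]
  refine integral_congr_ae (Filter.Eventually.of_forall fun ω ↦ ?_)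
  change (A ∩ B).indicator (1 : SiteConfig V → ℝ) ω = A.indicator 1 ω * B.indicator 1 ω
  rw [inter_indicator_one]
  rfl

/-- **An observable read through finitely many sites is measurable**: `ω ↦ g (ω ∩ A)` factors through the
finitely-valued measurable map `ω ↦ A ∩ ω` into `Finset V`. -/
theorem measurable_comp_inter_of_finite [Countable V] {β : Type*} [MeasurableSpace β] {A : Set V}
    (hA : A.Finite) (g : SiteConfig V → β) : Measurable fun ω : SiteConfig V ↦ g (ω ∩ A) := by
  classical
  set ψ : SiteConfig V → Finset V := fun ω ↦ hA.toFinset.filter (· ∈ ω) with hψ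
  have hψm : Measurable ψ := by
    refine measurable_finset_iff.2 fun a ↦ ?_
    have : (fun ω ↦ a ∈ ψ ω) = fun ω : SiteConfig V ↦ a ∈ A ∧ a ∈ ω := by
      funext ω; simp [hψ]
    rw [this]
    exact measurable_const.and (measurable_set_mem a)
  have hfac : (fun ω : SiteConfig V ↦ g (ω ∩ A)) = (fun T : Finset V ↦ g ↑T) ∘ ψ := by
    funext ω
    simp only [Function.comp_apply, hψ, Finset.coe_filter, hA.mem_toFinset]
    congr 1
    ext x
    simp [and_comm]
  rw [hfac]
  exact (measurable_of_countable _).comp hψm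

end Indep

/-! ## §3 Bookkeeping for the nesting weight -/

section Weight

/-- **A loop whose winding interior contains, or misses, the support of a neutral density weighs `1`**:
its phase `∫_{W ≠ 0} f` is `∫ f = 0` in the first case and `0` in the second, and `cos_μ(0) = 1`
(`nestingFactor_eq_one_of_nestingPhase_eq_zero`). -/
theorem nestingFactor_eq_one_of_subset_or_disjoint {f : ℂ → ℝ} {G : Set ℂ} {u : UnbasedLoop ℂ}
    (hf : ∀ z, f z ≠ 0 → z ∈ G) (hf0 : ∫ z, f z = 0)
    (h : G ⊆ {z | u.wind z ≠ 0} ∨ Disjoint G {z | u.wind z ≠ 0}) : u.nestingFactor f = 1 := by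
  refine UnbasedLoop.nestingFactor_eq_one_of_nestingPhase_eq_zero ?_
  rw [UnbasedLoop.nestingPhase]
  rcases h with h | h
  · rw [setIntegral_eq_integral_of_forall_compl_eq_zero fun z hz ↦ ?_, hf0]
    by_contra hfz
    exact hz (h (hf z hfz))
  · refine setIntegral_eq_zero_of_forall_eq_zero fun z hz ↦ ?_
    by_contra hfz
    exact Set.disjoint_left.1 h (hf z hfz) hz

/-- A `finprod` over `s` equals the `finprod` over a subset `t` off which all factors are `1`
(no finiteness needed: `finprod_mem_inter_mulSupport_eq`). -/
theorem finprod_mem_eq_of_eq_one_off {α M : Type*} [CommMonoid M] {s t : Set α} (hts : t ⊆ s) (g : α → M)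
    (h : ∀ a ∈ s, a ∉ t → g a = 1) : ∏ᶠ a ∈ s, g a = ∏ᶠ a ∈ t, g a := by
  refine finprod_mem_inter_mulSupport_eq g s t (Set.ext fun a ↦ ⟨fun ha ↦ ⟨?_, ha.2⟩, fun ha ↦ ⟨hts ha.1, ha.2⟩⟩)
  by_contra hat
  exact ha.2 (h a ha.1 hat)

/-- A set integral of a real function is the integral of the function times the indicator of the set. -/
theorem setIntegral_eq_integral_mul_indicator_one {Ω : Type*} [MeasurableSpace Ω] {μ : Measure Ω}
    {s : Set Ω} (hs : MeasurableSet s) (φ : Ω → ℝ) :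
    ∫ ω in s, φ ω ∂μ = ∫ ω, φ ω * s.indicator 1 ω ∂μ := by
  rw [← integral_indicator hs]
  refine integral_congr_ae (Filter.Eventually.of_forall fun ω ↦ ?_)
  by_cases h : ω ∈ s
  · simp [indicator_of_mem h]
  · simp [indicator_of_notMem h]

end Weight

end Summit.CriticalPhenomena.CardyFormulaZ2.Cruxes.NestingRigidity.MarkovCascadeOneGeneration

end
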